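import Mathlib
import Summits.KontsevichZagierPeriods.Zeta5Search.TypeSpaceLawZeroFinal
import HarnessLib

/-!
# ζ(5) search — `ResidueLaw.TypeSpaceLawZeroPoint` IS A THEOREM: all orbit points equal ⇒ `v_p(Cas_j(b)) ≥ 7 − 2M = casLB + 4`

HONEST FRAMING: systematic search; no irrationality claim unless certified.

Cell `pub-zeta5`, prover seat p3 (gen 2).  gen-2 g11's "ONE POINT" form of the zero-regime type-space law (REPORT-gen2-g11 §4, `𝒲 = 0`;
exact census 553 instances, minimum excess exactly 4).  No third-order digit is needed: with typer g11's `aggregate₃`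
(`W/(−p)^{3−M} = −pX + O(p²)`, `X ≡ Σ_z k_z P_z (mod p)`, `4Σ_z k_z = Res₀`) and the residue congruence `Res₀ ≡ 0 (mod p)`
(`ResidueLaw.res0_padicNorm_le`, from THEOREM R), the hypothesis "all doubled orbit points of the live classes are congruent mod `p`" gives
`X ≡ (Σ_z k_z)·P₀ ≡ 0`, hence `W/(−p)^{3−M} = O(p²)`, `V/(−p)^{−M} = O(p²)` for `b` AND for `b + e_j` (`point_transfer`: the live classes of
`b + e_j` are live classes of `b` with the same points), so `Cas_j = W⁺V − WV⁺ = (−p)^{3−2M}·O(p⁴)`.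
`p`-adic valuations of rational numbers; nothing here bears on irrationality.
-/

noncomputable section

open Finset

namespace Summit.KontsevichZagierPeriods.Zeta5Search.SecondOrder

open Summit.KontsevichZagierPeriods.Zeta5Search.DualSeries (InBox)
open Summit.KontsevichZagierPeriods.Zeta5Search.WedgeDictionary (coeffW coeffV)
open Summit.KontsevichZagierPeriods.Zeta5Search.CasoratianValuation (InPolytope shift casoratian)
open Summit.KontsevichZagierPeriods.Zeta5Search.ClusterValuation
open Summit.KontsevichZagierPeriods.Zeta5Search.PadicSeries
open Summit.KontsevichZagierPeriods.Zeta5Search.BigPrime (shift_zero)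
open Summit.KontsevichZagierPeriods.Zeta5Search.ResidueLaw (pointW pointV liveClasses res0_padicNorm_le sum_classExp_range)
open Summit.KontsevichZagierPeriods.Zeta5Search.BigPrime (dOf_shift)

variable {p : ℕ} [hp : Fact p.Prime]

/-- An aggregate `Z` with `‖Z − Σ_z c_z f_z‖ ≤ p⁻¹`, `c_z` integral, and every term with `c_z ≠ 0` having `‖f_z − P‖ ≤ p⁻¹` for a fixed integral
`P`, while `‖Σ_z c_z‖ ≤ p⁻¹`: then `‖Z‖ ≤ p⁻¹`. -/
theorem norm_le_of_equal_points {Z P : ℚ} {c f : ℕ → ℚ}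
    (hZ : padicNorm p (Z - ∑ z ∈ range p, c z * f z) ≤ (p : ℚ) ^ (-(1 : ℤ)))
    (hc : padicNorm p (∑ z ∈ range p, c z) ≤ (p : ℚ) ^ (-(1 : ℤ))) (hc1 : ∀ z, padicNorm p (c z) ≤ 1) (hP : padicNorm p P ≤ 1)
    (hf : ∀ z, c z ≠ 0 → padicNorm p (f z - P) ≤ (p : ℚ) ^ (-(1 : ℤ))) :
    padicNorm p Z ≤ (p : ℚ) ^ (-(1 : ℤ)) := by
  have h1 : ∑ z ∈ range p, c z * (f z - P) = (∑ z ∈ range p, c z * f z) - (∑ z ∈ range p, c z) * P := by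
    rw [sum_mul, ← sum_sub_distrib]
    exact sum_congr rfl fun z _ => by ring
  have e : Z = (Z - ∑ z ∈ range p, c z * f z) + (∑ z ∈ range p, c z * (f z - P)) + (∑ z ∈ range p, c z) * P := by
    rw [h1]; ring
  rw [e]
  refine (padicNorm.nonarchimedean (p := p)).trans (max_le ((padicNorm.nonarchimedean (p := p)).trans (max_le hZ ?_)) ?_)
  · refine padicNorm.sum_le' (fun z _ => ?_) (zpow_p_nonneg _)
    by_cases hcz : c z = 0
    · rw [hcz, zero_mul, padicNorm.zero]; exact zpow_p_nonneg _
    · rw [padicNorm.mul]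
      calc padicNorm p (c z) * padicNorm p (f z - P) ≤ 1 * (p : ℚ) ^ (-(1 : ℤ)) :=
            mul_le_mul (hc1 z) (hf z hcz) (padicNorm.nonneg _) zero_le_one
        _ = _ := one_mul _
  · rw [padicNorm.mul]
    calc padicNorm p (∑ z ∈ range p, c z) * padicNorm p P ≤ (p : ℚ) ^ (-(1 : ℤ)) * 1 :=
          mul_le_mul hc hP (padicNorm.nonneg _) (zpow_p_nonneg _)
      _ = _ := mul_one _

/-- `w = −pX + O(p²)` with `‖X‖ ≤ p⁻¹` gives `‖w‖ ≤ p⁻²`. -/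
theorem norm_le_two_of_X {w X : ℚ} (hw : padicNorm p (w + (p : ℚ) * X) ≤ (p : ℚ) ^ (-(2 : ℤ)))
    (hX : padicNorm p X ≤ (p : ℚ) ^ (-(1 : ℤ))) : padicNorm p w ≤ (p : ℚ) ^ (-(2 : ℤ)) := by
  have hp0 : (p : ℚ) ≠ 0 := Nat.cast_ne_zero.2 hp.out.ne_zero
  have e : w = (w + (p : ℚ) * X) + (-((p : ℚ) * X)) := by ring
  rw [e]
  refine (padicNorm.nonarchimedean (p := p)).trans (max_le hw ?_)
  rw [padicNorm.neg, padicNorm.mul, padicNorm.padicNorm_p_of_prime]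
  calc (p : ℚ)⁻¹ * padicNorm p X ≤ (p : ℚ)⁻¹ * (p : ℚ) ^ (-(1 : ℤ)) :=
        mul_le_mul_of_nonneg_left hX (inv_nonneg.2 (Nat.cast_nonneg p))
    _ = (p : ℚ) ^ (-(2 : ℤ)) := by
        rw [← zpow_neg_one, ← zpow_add₀ hp0]; norm_num

/-- **TYPE-SPACE LAW, ZERO REGIME, ONE POINT — conditional form**: the class hypotheses of `TypeSpaceLawZeroPoint`, the residue congruences for
`b` and `b + e_j`, and all live doubled orbit points congruent mod `p` give `v_p(Cas_j(b)) ≥ 7 − 2M`. -/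
theorem typeSpaceLawZeroPoint_of_residues (b : ℕ → ℤ) (p j M : ℕ) (hb : InPolytope b) (hb' : InPolytope (shift b j))
    (hj1 : 1 ≤ j) (hj7 : j ≤ 7) (hprime : p.Prime) (hp5 : 5 ≤ p) (hpb : (p : ℤ) ≤ b 0) (hwin : (b 0 + 2 : ℤ) < (p : ℤ) ^ 2)
    (hM : 6 ≤ M) (hMe : Even M)
    (G1 : ∀ x, x < p → 1 ≤ classPoleCount b p x → -(M : ℤ) ≤ classExp b p x)
    (G3 : ∀ x, x < p → 1 ≤ classPoleCount b p x → classExp b p x = -(M : ℤ) →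
      ¬ CentreIn b p x ∧ (classTypeList b p x).reverse = classTypeList b p x)
    (HP : ∀ x ∈ liveClasses b p M, ∀ y ∈ liveClasses b p M,
        (pointW b p M y - pointW b p M x = 0 ∨ 1 ≤ padicValRat p (pointW b p M y - pointW b p M x)) ∧
        (pointV b p M y - pointV b p M x = 0 ∨ 1 ≤ padicValRat p (pointV b p M y - pointV b p M x)))
    (hres : padicNorm p
      ((∑ z ∈ (range p).filter (fun x => 1 ≤ classPoleCount b p x ∧ classExp b p x = -(M : ℤ)), gHat b p z * phiHat b p z)
        + ∑ z ∈ (range p).filter (fun x => 1 ≤ classPoleCount b p x ∧ classExp b p x = -(M : ℤ) + 1), gHat b p z)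
      ≤ (p : ℚ) ^ (-(1 : ℤ)))
    (hres' : padicNorm p
      ((∑ z ∈ (range p).filter (fun x => 1 ≤ classPoleCount (shift b j) p x ∧ classExp (shift b j) p x = -(M : ℤ)),
          gHat (shift b j) p z * phiHat (shift b j) p z)
        + ∑ z ∈ (range p).filter (fun x => 1 ≤ classPoleCount (shift b j) p x ∧ classExp (shift b j) p x = -(M : ℤ) + 1),
          gHat (shift b j) p z)
      ≤ (p : ℚ) ^ (-(1 : ℤ)))
    (hcas : casoratian b j ≠ 0) : (7 : ℤ) - 2 * M ≤ padicValRat p (casoratian b j) := by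
  haveI : Fact p.Prime := ⟨hprime⟩
  have hp0 : (p : ℚ) ≠ 0 := Nat.cast_ne_zero.2 hprime.ne_zero
  have hpneg : (-(p : ℚ)) ≠ 0 := neg_ne_zero.2 hp0
  have hp2 : p ≠ 2 := by omega
  have h0 : 0 ≤ b 0 := hb.1.1
  obtain ⟨-, -, -, hn⟩ := thmA_data b hb hwin
  have h4n : padicNorm p (4 : ℚ) = 1 := by
    rw [show (4 : ℚ) = 2 * 2 by norm_num, padicNorm.mul, padicNorm_two hp2, one_mul]
  -- the aggregates for `b` and `b + e_j`
  obtain ⟨X, Y, k, hX1, hY1, hW, hV, hk1, hkL, hksum, hXa, hYa⟩ := aggregate₃ b hb hp5 hpb hwin hM hMe G1 G3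
  have hpb' : (p : ℤ) ≤ shift b j 0 := by rw [shift_zero b hj1]; exact hpb
  have hwin' : (shift b j 0 + 2 : ℤ) < (p : ℤ) ^ 2 := by rw [shift_zero b hj1]; exact hwin
  obtain ⟨X', Y', k', hX1', hY1', hW', hV', hk1', hkL', hksum', hXa', hYa'⟩ := aggregate₃ (shift b j) hb' hp5 hpb' hwin' hM hMe
    (G1_shift b hb hj1 G1) (G3_shift b hb hb' hj1 hj7 hpb G1 G3)
  have hPt : ∀ z, k' z ≠ 0 → z ∈ liveClasses b p M ∧ pointW (shift b j) p M z = pointW b p M z ∧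
      pointV (shift b j) p M z = pointV b p M z := fun z hz =>
    point_transfer b hb hb' hj1 hj7 hpb hM hMe G1 G3 (hkL' z hz)
  -- a base point
  obtain ⟨x₀, hx₀⟩ : ∃ x₀, ∀ z ∈ liveClasses b p M, x₀ ∈ liveClasses b p M := by
    by_cases h : (liveClasses b p M).Nonempty
    · obtain ⟨x, hx⟩ := h; exact ⟨x, fun _ _ => hx⟩
    · exact ⟨0, fun z hz => absurd ⟨z, hz⟩ h⟩
  have hP0 := padicNorm_point_le_one b h0 hn hp2 M x₀
  -- the weight sums are `O(p)`
  have hsum : padicNorm p (∑ z ∈ range p, k z) ≤ (p : ℚ) ^ (-(1 : ℤ)) := by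
    have e : ∑ z ∈ range p, k z = (4 * ∑ z ∈ range p, k z) / 4 := by ring
    rw [e, padicNorm.div, h4n, div_one, hksum]; exact hres
  have hsum' : padicNorm p (∑ z ∈ range p, k' z) ≤ (p : ℚ) ^ (-(1 : ℤ)) := by
    have e : ∑ z ∈ range p, k' z = (4 * ∑ z ∈ range p, k' z) / 4 := by ring
    rw [e, padicNorm.div, h4n, div_one, hksum']; exact hres'
  -- all points equal mod `p` ⇒ the aggregates vanish mod `p`
  have hXp : padicNorm p X ≤ (p : ℚ) ^ (-(1 : ℤ)) :=
    norm_le_of_equal_points hXa hsum hk1 hP0.1 fun z hz =>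
      padicNorm_le_of_zero_or_val (HP x₀ (hx₀ z (hkL z hz)) z (hkL z hz)).1
  have hYp : padicNorm p Y ≤ (p : ℚ) ^ (-(1 : ℤ)) :=
    norm_le_of_equal_points hYa hsum hk1 hP0.2 fun z hz =>
      padicNorm_le_of_zero_or_val (HP x₀ (hx₀ z (hkL z hz)) z (hkL z hz)).2
  have hXp' : padicNorm p X' ≤ (p : ℚ) ^ (-(1 : ℤ)) :=
    norm_le_of_equal_points hXa' hsum' hk1' hP0.1 fun z hz => by
      obtain ⟨hzL, hPW, -⟩ := hPt z hz
      rw [hPW]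
      exact padicNorm_le_of_zero_or_val (HP x₀ (hx₀ z hzL) z hzL).1
  have hYp' : padicNorm p Y' ≤ (p : ℚ) ^ (-(1 : ℤ)) :=
    norm_le_of_equal_points hYa' hsum' hk1' hP0.2 fun z hz => by
      obtain ⟨hzL, -, hPV⟩ := hPt z hz
      rw [hPV]
      exact padicNorm_le_of_zero_or_val (HP x₀ (hx₀ z hzL) z hzL).2
  -- ### the normalised forms are `O(p²)`
  set w := coeffW b / (-(p : ℚ)) ^ (-(M : ℤ) + 3)
  set v := coeffV b / (-(p : ℚ)) ^ (-(M : ℤ))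
  set w' := coeffW (shift b j) / (-(p : ℚ)) ^ (-(M : ℤ) + 3)
  set v' := coeffV (shift b j) / (-(p : ℚ)) ^ (-(M : ℤ))
  have hw := norm_le_two_of_X hW hXp
  have hv := norm_le_two_of_X hV hYp
  have hw' := norm_le_two_of_X hW' hXp'
  have hv' := norm_le_two_of_X hV' hYp'
  have hdet : padicNorm p (w' * v - w * v') ≤ (p : ℚ) ^ (-(4 : ℤ)) := by
    have h44 : (p : ℚ) ^ (-(2 : ℤ)) * (p : ℚ) ^ (-(2 : ℤ)) = (p : ℚ) ^ (-(4 : ℤ)) := by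
      rw [← zpow_add₀ hp0]; norm_num
    rw [sub_eq_add_neg]
    refine (padicNorm.nonarchimedean (p := p)).trans (max_le ?_ ?_)
    · rw [padicNorm.mul, ← h44]
      exact mul_le_mul hw' hv (padicNorm.nonneg _) (zpow_p_nonneg _)
    · rw [padicNorm.neg, padicNorm.mul, ← h44]
      exact mul_le_mul hw hv' (padicNorm.nonneg _) (zpow_p_nonneg _)
  have hcasE : casoratian b j = (-(p : ℚ)) ^ (-(M : ℤ) + 3) * (-(p : ℚ)) ^ (-(M : ℤ)) * (w' * v - w * v') := by
    have e1 : coeffW b = w * (-(p : ℚ)) ^ (-(M : ℤ) + 3) := by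
      simp only [w]; rw [div_mul_cancel₀ _ (zpow_ne_zero _ hpneg)]
    have e2 : coeffV b = v * (-(p : ℚ)) ^ (-(M : ℤ)) := by
      simp only [v]; rw [div_mul_cancel₀ _ (zpow_ne_zero _ hpneg)]
    have e3 : coeffW (shift b j) = w' * (-(p : ℚ)) ^ (-(M : ℤ) + 3) := by
      simp only [w']; rw [div_mul_cancel₀ _ (zpow_ne_zero _ hpneg)]
    have e4 : coeffV (shift b j) = v' * (-(p : ℚ)) ^ (-(M : ℤ)) := by
      simp only [v']; rw [div_mul_cancel₀ _ (zpow_ne_zero _ hpneg)]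
    unfold casoratian
    rw [e1, e2, e3, e4]; ring
  apply val_ge_of_padicNorm_le hcas
  rw [hcasE, padicNorm.mul, padicNorm.mul, LevelClass.padicNorm_neg_p_zpow, LevelClass.padicNorm_neg_p_zpow]
  calc (p : ℚ) ^ (-(-(M : ℤ) + 3)) * (p : ℚ) ^ (-(-(M : ℤ))) * padicNorm p (w' * v - w * v')
      ≤ (p : ℚ) ^ (-(-(M : ℤ) + 3)) * (p : ℚ) ^ (-(-(M : ℤ))) * (p : ℚ) ^ (-(4 : ℤ)) :=
        mul_le_mul_of_nonneg_left hdet (mul_nonneg (zpow_p_nonneg _) (zpow_p_nonneg _))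
    _ = (p : ℚ) ^ (-((7 : ℤ) - 2 * M)) := by
        rw [← zpow_add₀ hp0, ← zpow_add₀ hp0]; congr 1; ring

end Summit.KontsevichZagierPeriods.Zeta5Search.SecondOrder

namespace Summit.KontsevichZagierPeriods.Zeta5Search.ResidueLaw

open Summit.KontsevichZagierPeriods.Zeta5Search.ClusterValuation
open Summit.KontsevichZagierPeriods.Zeta5Search.SecondOrder (typeSpaceLawZeroPoint_of_residues G1_shift)
open Summit.KontsevichZagierPeriods.Zeta5Search.CasoratianValuation (InPolytope shift casoratian)
open Summit.KontsevichZagierPeriods.Zeta5Search.BigPrime (shift_zero dOf_shift)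

/-- **THE TYPE-SPACE LAW, ZERO REGIME, ONE POINT, IS A THEOREM** (`ResidueLaw.TypeSpaceLawZeroPoint`, gen-2 g11 §4, `𝒲 = 0`):
`v_p(Cas_j(b)) ≥ 7 − 2M = casLB + 4`. -/
theorem typeSpaceLawZeroPoint_holds : TypeSpaceLawZeroPoint := by
  intro b p j M hb hb' hj1 hj7 hprime hp5 hpb hwin hM hMe G1 G3 hdeg HP hcas
  haveI : Fact p.Prime := ⟨hprime⟩
  have hdegb : (p : ℤ) * ((M : ℤ) - 2) + ∑ x ∈ range p, classExp b p x ≤ -2 := by omega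
  have hsum : ∑ x ∈ range p, classExp (shift b j) p x = ∑ x ∈ range p, classExp b p x + 2 := by
    rw [sum_classExp_range (shift b j) hb' hp5, sum_classExp_range b hb hp5, dOf_shift b hj1 hj7]
    ring
  have hdeg' : (p : ℤ) * ((M : ℤ) - 2) + ∑ x ∈ range p, classExp (shift b j) p x ≤ -2 := by omega
  have hpb' : (p : ℤ) ≤ shift b j 0 := by rw [shift_zero b hj1]; exact hpb
  exact typeSpaceLawZeroPoint_of_residues b p j M hb hb' hj1 hj7 hprime hp5 hpb hwin hM hMe G1 G3 HP
    (res0_padicNorm_le b M hb hp5 hpb (by omega) G1 hdegb)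
    (res0_padicNorm_le (shift b j) M hb' hp5 hpb' (by omega) (G1_shift b hb hj1 G1) hdeg') hcas

end Summit.KontsevichZagierPeriods.Zeta5Search.ResidueLaw
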